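import Literature.MathematicalPhysics.QuantumLattice.FreeFermiGasPairingCostOptimal
import Literature.MathematicalPhysics.QuantumLattice.TorusInverseGapSumLog
import HarnessLib

/-!
# `d`-wave pair LRO costs kinetic energy at the rate `a / log²(1/a)` — uniformly in the filling

Family `hubbard` / topic `MathematicalPhysics/QuantumLattice`; fifth stage of the pairing-cost files
(`a⁶`, `a²`, `a^{3/2}` uniform in the filling; `a/log(1/a)` at fillings whose Fermi level avoids the
van Hove level, `FreeFermiGasPairingCostLog.lean`). With the SAME operator input as the `a^{3/2}`
rate (triangle bounds `√(a/8)L² ≤ 2Σ√dev + 2L`, exact bathtub identity `Σ|ξ|dev ≤ K`, one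
Cauchy–Schwarz against `Σ 1/|ξ|`) and the two LEVEL-UNIFORM logarithmic counting estimates of
`TorusShellCountLog.lean` (`#{|ξ| < e₀} ≤ 6e₀ log(4/e₀) L² + 52 L`) and `TorusInverseGapSumLog.lean`
(`Σ_{|ξ| ≥ e₀} 1/|ξ| ≤ 20 L² log²(4/e₀) + 70 L/e₀`):

* `freeDWavePairing_costs_energy_uniform_explicit`: for `a > 0`, `L ≥ 3` with `√a·L ≥ 3200`, and a
  unit `ψ ∈ szSector (2n) 0` — ANY `n` — with `Re ⟨ψ, Δ_d†Δ_d ψ⟩ ≥ a·L⁴`: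
  `minEnergyOn H₀ (szSector (2n) 0) + a / (10⁵ · log²(4 + 32/√a)) · L² ≤ Re ⟨ψ, H₀ ψ⟩`,
  `H₀ = hubbardTorus 2 L 1 0`; `…_uniform_rate`: the same for every `N` and `L ≥ ⌈3200/√a⌉ + 3`;
  `re_expect_pairField_dWave_lt_of_energy_excess_lt_uniform`: the a-priori form.

No Fermi-level hypothesis, no parity of `L`, no doping: the square of the logarithm is the price of
the van Hove filling (where a BCS trial state indeed pairs at kinetic cost `≍ a L²/log²(1/a)`, so the
rate is optimal for a level-uniform statement), and away from it the statement is weaker than the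
`a/log(1/a)` rate by one logarithm only. Consumers: `HubbardPairDensityCouplingCeilingUniform.lean`
(ground-state `d`-wave pair density of the repulsive Hubbard torus is `O(U log²(1/U))` at EVERY
filling) and the Summits-side uniform window ceiling of crux `BirGroundStateAverageLRO`.

Sources: J. Bardeen, L. N. Cooper, J. R. Schrieffer, Phys. Rev. 108 (1957) 1175, §II–III;
L. Van Hove, Phys. Rev. 89 (1953) 1189 (the logarithmic density of states); E. H. Lieb, M. Loss,
Analysis (2001), Thm 1.14; C. N. Yang, Rev. Mod. Phys. 34 (1962) 694, §3. Folklore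
finite-dimensional statements; no named facts, no definitions.

## Mathlib / tree search

Tree: `sqrt_le_deviation_of_le_re_expect_pairField_dWave`, `exists_fermiSet_deviation_le_energy_excess`,
`card_torusShell_lt_le_log`, `sum_inv_abs_sub_le_log_sq`, `log_four_ge`,
`freeDWavePairing_costs_energy_opt_explicit` (rate `a^{3/2}`), `freeDWavePairing_costs_energy_log_explicit`.
Mathlib: `Real.sum_sqrt_mul_sqrt_le`, `Real.log_le_sub_one_of_pos`, `Real.log_mul`, `Real.log_pow`,
`Real.log_le_log`, `Real.log_nonneg`, `le_of_pow_le_pow_left₀`.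
-/

noncomputable section

namespace Literature.MathematicalPhysics.QuantumLattice

open Matrix Finset Literature.Probability.LatticeModels
open scoped ComplexOrder ComplexConjugate

variable {L : ℕ} [NeZero L]

/-- **`d`-wave pair LRO costs kinetic energy — the level-uniform logarithmic rate, explicit
constants.** For `a > 0`, `L ≥ 3` with `√a·L ≥ 3200`, a unit vector `ψ ∈ szSector (2n) 0` (any `n`)
with `Re ⟨ψ, Δ_d†Δ_d ψ⟩ ≥ a·L⁴`:
`minEnergyOn H₀ (szSector (2n) 0) + a/(10⁵·log²(4 + 32/√a))·L² ≤ Re ⟨ψ, H₀ ψ⟩`,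
`H₀ = hubbardTorus 2 L 1 0`. Proof: with `α = √(a/8)` (`≤ 3` by the triangle bound itself),
`ℓ₀ = log(4 + 32/√a)` and the window `e₀ = α/(512ℓ₀)` (`log(4/e₀) ≤ 7.5ℓ₀` because
`log(1/α) ≤ ℓ₀`): the window holds at most `αL²/10 + 52L` momenta (van-Hove-safe count), outside
`Σ√dev ≤ √K·√W` with `W ≤ 1200 ℓ₀² L²` (uniform logarithmic inverse-gap sum, `αL ≥ 1060`), whence
`(7α/10)L² ≤ 2√(KW)` and `a L² ≤ 78368 ℓ₀² K`. Bardeen–Cooper–Schrieffer (1957) §II; Van Hove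
(1953). [folklore] -/
theorem freeDWavePairing_costs_energy_uniform_explicit {a : ℝ} (ha : 0 < a) (hL : 3 ≤ L)
    (hLa : 3200 ≤ Real.sqrt a * L) {n : ℕ} {ψ : Fock (Orb (FermionTorus 2 L))}
    (hψ : ψ ∈ szSector (Λ := FermionTorus 2 L) (2 * n) 0) (h1 : star ψ ⬝ᵥ ψ = 1)
    (hY : a * (L : ℝ) ^ 4 ≤
      (star ψ ⬝ᵥ (((pairField dWaveFormFactor L)ᴴ * pairField dWaveFormFactor L) *ᵥ ψ)).re) :
    (hubbardTorus 2 L 1 0).minEnergyOn (szSector (Λ := FermionTorus 2 L) (2 * n) 0) +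
        a / (100000 * Real.log (4 + 32 / Real.sqrt a) ^ 2) * (L : ℝ) ^ 2 ≤
      (star ψ ⬝ᵥ (hubbardTorus 2 L 1 0 *ᵥ ψ)).re := by
  classical
  obtain ⟨F, eF, hFc, hF, hF', hdev⟩ := exists_fermiSet_deviation_le_energy_excess hL hψ h1
  -- occupations and deviations
  obtain ⟨x, hx⟩ : ∃ x : TorusSite 2 L → ℝ, ∀ k, (star ψ ⬝ᵥ (momentumNumber k 0 *ᵥ ψ)).re = x k :=
    ⟨_, fun _ => rfl⟩
  simp only [hx] at hdev
  have hx0 : ∀ k, 0 ≤ x k := fun k => by rw [← hx]; exact (re_expect_momentumNumber_mem_Icc k 0 ψ).1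
  have hx1 : ∀ k, x k ≤ 1 := fun k => by
    have := (re_expect_momentumNumber_mem_Icc k 0 ψ).2
    rwa [h1, Complex.one_re, hx] at this
  set dev : TorusSite 2 L → ℝ := fun k => if k ∈ F then 1 - x k else x k with hdev_def
  have hd0 : ∀ k, 0 ≤ dev k := fun k => by
    simp only [hdev_def]; split_ifs <;> linarith [hx0 k, hx1 k]
  have hd1 : ∀ k, dev k ≤ 1 := fun k => by
    simp only [hdev_def]; split_ifs <;> linarith [hx0 k, hx1 k]
  set K : ℝ := (star ψ ⬝ᵥ (hubbardTorus 2 L 1 0 *ᵥ ψ)).re -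
    (hubbardTorus 2 L 1 0).minEnergyOn (szSector (Λ := FermionTorus 2 L) (2 * n) 0) with hK
  set ξ : TorusSite 2 L → ℝ := fun k => |torusBand L k - eF| with hξ
  have hξ0 : ∀ k, 0 ≤ ξ k := fun k => abs_nonneg _
  have hdevK : ∑ k, ξ k * dev k ≤ K := hdev
  have hK0 : 0 ≤ K := le_trans (Finset.sum_nonneg fun k _ => mul_nonneg (hξ0 k) (hd0 k)) hdevK
  -- scales
  set α : ℝ := Real.sqrt (a / 8) with hα
  have hα0 : 0 < α := Real.sqrt_pos.2 (by positivity)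
  have hα2 : α ^ 2 = a / 8 := Real.sq_sqrt (by positivity)
  have hL0' : (0 : ℝ) < L := by exact_mod_cast (show 0 < L by omega)
  have hL3 : (3 : ℝ) ≤ L := by exact_mod_cast hL
  have hsa : Real.sqrt a = Real.sqrt 8 * α := by
    rw [hα, ← Real.sqrt_mul (by norm_num : (0 : ℝ) ≤ 8)]
    congr 1
    ring
  have hs8 : Real.sqrt 8 ≤ 3 := by
    rw [show (3 : ℝ) = Real.sqrt (3 ^ 2) from (Real.sqrt_sq (by norm_num)).symm]
    exact Real.sqrt_le_sqrt (by norm_num)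
  have hs80 : 0 ≤ Real.sqrt 8 := Real.sqrt_nonneg _
  -- Step 1: triangle bounds `α L² ≤ 2 Σ √dev + 2L`
  have hstep1 : α * (L : ℝ) ^ 2 ≤ 2 * ∑ k, Real.sqrt (dev k) + 2 * L := by
    have h := sqrt_le_deviation_of_le_re_expect_pairField_dWave F h1 hY
    simp only [hx] at h
    have hS : ∑ k ∈ Fᶜ, Real.sqrt (x k) + ∑ k ∈ F, Real.sqrt (1 - x k) = ∑ k, Real.sqrt (dev k) := by
      rw [← Finset.sum_add_sum_compl F fun k => Real.sqrt (dev k), add_comm]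
      congr 1
      · exact Finset.sum_congr rfl fun k hk => by
          rw [hdev_def]; dsimp only; rw [if_pos hk]
      · exact Finset.sum_congr rfl fun k hk => by
          rw [hdev_def]; dsimp only; rw [if_neg (Finset.mem_compl.1 hk)]
    have hFx : Real.sqrt (∑ k ∈ F, x k) ≤ L := by
      have hle : ∑ k ∈ F, x k ≤ (L : ℝ) ^ 2 := by
        calc ∑ k ∈ F, x k ≤ ∑ k ∈ F, (1 : ℝ) := Finset.sum_le_sum fun k _ => hx1 k
          _ = F.card := by rw [Finset.sum_const, nsmul_eq_mul, mul_one]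
          _ ≤ (L : ℝ) ^ 2 := by
              have := Finset.card_le_univ F
              rw [card_torusSite] at this
              exact_mod_cast this
      calc Real.sqrt (∑ k ∈ F, x k) ≤ Real.sqrt ((L : ℝ) ^ 2) := Real.sqrt_le_sqrt hle
        _ = L := Real.sqrt_sq hL0'.le
    rw [← hα] at h
    linarith
  -- `α ≤ 3` (from Step 1 and `Σ √dev ≤ L²`), hence `1/α ≤ 4 + 32/√a`
  have hsumle : ∑ k, Real.sqrt (dev k) ≤ (L : ℝ) ^ 2 := by
    calc ∑ k, Real.sqrt (dev k) ≤ ∑ _k : TorusSite 2 L, (1 : ℝ) :=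
          Finset.sum_le_sum fun k _ => by
            rw [show (1 : ℝ) = Real.sqrt 1 from Real.sqrt_one.symm]
            exact Real.sqrt_le_sqrt (hd1 k)
      _ = (L : ℝ) ^ 2 := by
          rw [Finset.sum_const, Finset.card_univ, card_torusSite, nsmul_eq_mul, mul_one]
          push_cast
          ring
  have hα3 : α ≤ 3 := by
    have h3L : 3 * (L : ℝ) ≤ (L : ℝ) ^ 2 := by
      calc 3 * (L : ℝ) ≤ L * L := mul_le_mul_of_nonneg_right hL3 hL0'.le
        _ = (L : ℝ) ^ 2 := by ring
    have h : α * (L : ℝ) ^ 2 ≤ 3 * (L : ℝ) ^ 2 := by linarith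
    exact le_of_mul_le_mul_right h (by positivity)
  set ℓ₀ : ℝ := Real.log (4 + 32 / Real.sqrt a) with hℓ₀
  have hlog4 := log_four_ge
  have hsqa0 : 0 < Real.sqrt a := Real.sqrt_pos.2 ha
  have hℓ4 : Real.log 4 ≤ ℓ₀ := by
    refine Real.log_le_log (by norm_num) ?_
    have : 0 ≤ 32 / Real.sqrt a := by positivity
    linarith
  have hℓ0 : 0 < ℓ₀ := by linarith
  have hinvα : 1 / α ≤ 4 + 32 / Real.sqrt a := by
    have h32 : 1 / α ≤ 32 / Real.sqrt a := by
      rw [hsa, div_le_div_iff₀ hα0 (by positivity)]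
      have := mul_le_mul_of_nonneg_right hs8 hα0.le
      linarith
    have : (0 : ℝ) ≤ 4 := by norm_num
    linarith
  have hlogα : Real.log (1 / α) ≤ ℓ₀ := Real.log_le_log (by positivity) hinvα
  -- Step 2: the window `e₀ = α / (512 ℓ₀)`
  set e₀ : ℝ := α / (512 * ℓ₀) with he₀
  have he0 : 0 < e₀ := by positivity
  have he1 : e₀ ≤ 1 := by
    rw [he₀, div_le_one (by positivity)]
    linarith
  have h4e : 4 / e₀ = 2048 * ℓ₀ * (1 / α) := by
    rw [he₀]
    field_simp
    ring
  have hΛ : Real.log (4 / e₀) ≤ 15 / 2 * ℓ₀ := by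
    rw [h4e, Real.log_mul (by positivity) (by positivity), Real.log_mul (by norm_num) hℓ0.ne']
    have h2048 : Real.log 2048 = 11 * Real.log 2 := by
      rw [show (2048 : ℝ) = 2 ^ 11 by norm_num, Real.log_pow]; norm_num
    have hl4 : Real.log 4 = 2 * Real.log 2 := by
      rw [show (4 : ℝ) = 2 ^ 2 by norm_num, Real.log_pow]; norm_num
    have hlogℓ : Real.log ℓ₀ ≤ ℓ₀ - 1 := Real.log_le_sub_one_of_pos hℓ0
    rw [h2048]
    rw [hl4] at hℓ4
    linarith
  have hΛ0 : 0 ≤ Real.log (4 / e₀) := by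
    refine Real.log_nonneg ?_
    rw [le_div_iff₀ he0]; linarith
  -- the window holds few momenta (van-Hove-safe count)
  have hwindow : ∑ k ∈ Finset.univ.filter (fun k => ¬ e₀ ≤ ξ k), Real.sqrt (dev k) ≤
      α / 10 * (L : ℝ) ^ 2 + 52 * L := by
    calc ∑ k ∈ Finset.univ.filter (fun k => ¬ e₀ ≤ ξ k), Real.sqrt (dev k)
        ≤ ∑ k ∈ Finset.univ.filter (fun k => ¬ e₀ ≤ ξ k), (1 : ℝ) :=
          Finset.sum_le_sum fun k _ => by
            rw [show (1 : ℝ) = Real.sqrt 1 from Real.sqrt_one.symm]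
            exact Real.sqrt_le_sqrt (hd1 k)
      _ = ((Finset.univ.filter (fun k => ¬ e₀ ≤ ξ k)).card : ℝ) := by
          rw [Finset.sum_const, nsmul_eq_mul, mul_one]
      _ = ((Finset.univ.filter (fun k : TorusSite 2 L => |torusBand L k - eF| < e₀)).card : ℝ) := by
          congr 2
          refine Finset.filter_congr fun k _ => ?_
          rw [hξ, not_le]
      _ ≤ 6 * e₀ * Real.log (4 / e₀) * (L : ℝ) ^ 2 + 52 * L := card_torusShell_lt_le_log he0 he1 eF
      _ ≤ α / 10 * (L : ℝ) ^ 2 + 52 * L := by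
          have h6 : 6 * e₀ * Real.log (4 / e₀) ≤ α / 10 := by
            calc 6 * e₀ * Real.log (4 / e₀) ≤ 6 * e₀ * (15 / 2 * ℓ₀) :=
                  mul_le_mul_of_nonneg_left hΛ (by positivity)
              _ = 45 / 512 * α := by
                  rw [he₀]
                  field_simp
                  ring
              _ ≤ α / 10 := by linarith
          have := mul_le_mul_of_nonneg_right h6 (sq_nonneg (L : ℝ))
          linarith
  -- outside the window: Cauchy–Schwarz against the uniform logarithmic inverse-gap sum
  set W : ℝ := 20 * (L : ℝ) ^ 2 * Real.log (4 / e₀) ^ 2 + 70 * L / e₀ with hW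
  have hW0 : 0 ≤ W := by positivity
  have houtside : ∑ k ∈ Finset.univ.filter (fun k => e₀ ≤ ξ k), Real.sqrt (dev k) ≤
      Real.sqrt K * Real.sqrt W := by
    have hcs := Real.sum_sqrt_mul_sqrt_le (Finset.univ.filter (fun k => e₀ ≤ ξ k))
      (f := fun k => ξ k * dev k) (g := fun k => 1 / ξ k)
      (fun k => mul_nonneg (hξ0 k) (hd0 k)) (fun k => by positivity)
    have heq : ∀ k ∈ Finset.univ.filter (fun k => e₀ ≤ ξ k),
        Real.sqrt (dev k) = Real.sqrt (ξ k * dev k) * Real.sqrt (1 / ξ k) := by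
      intro k hk
      have hk' : 0 < ξ k := lt_of_lt_of_le he0 (Finset.mem_filter.1 hk).2
      rw [← Real.sqrt_mul (mul_nonneg (hξ0 k) (hd0 k)), mul_comm (ξ k), mul_assoc,
        mul_one_div_cancel hk'.ne', mul_one]
    rw [Finset.sum_congr rfl heq]
    refine hcs.trans (mul_le_mul ?_ ?_ (Real.sqrt_nonneg _) (Real.sqrt_nonneg _))
    · refine Real.sqrt_le_sqrt (le_trans ?_ hdevK)
      exact Finset.sum_le_sum_of_subset_of_nonneg (Finset.filter_subset _ _)
        fun k _ _ => mul_nonneg (hξ0 k) (hd0 k)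
    · exact Real.sqrt_le_sqrt ((sum_inv_abs_sub_le_log_sq (L := L) eF he0 he1).trans (le_of_eq rfl))
  have hsplit : ∑ k, Real.sqrt (dev k) =
      ∑ k ∈ Finset.univ.filter (fun k => e₀ ≤ ξ k), Real.sqrt (dev k) +
        ∑ k ∈ Finset.univ.filter (fun k => ¬ e₀ ≤ ξ k), Real.sqrt (dev k) :=
    (Finset.sum_filter_add_sum_filter_not _ _ _).symm
  -- Step 3: the threshold `α L ≥ 1060`, combine and square
  have hαL : 1060 ≤ α * L := by
    have : Real.sqrt a * L ≤ 3 * (α * L) := by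
      rw [hsa]
      have := mul_le_mul_of_nonneg_right hs8 (mul_pos hα0 hL0').le
      linarith [show Real.sqrt 8 * α * L = Real.sqrt 8 * (α * L) by ring]
    linarith
  have hmain : 7 / 10 * α * (L : ℝ) ^ 2 ≤ 2 * (Real.sqrt K * Real.sqrt W) := by
    have h106 : 106 * (L : ℝ) ≤ α / 10 * (L : ℝ) ^ 2 := by
      have := mul_le_mul_of_nonneg_right hαL hL0'.le
      calc 106 * (L : ℝ) = (1 / 10) * (1060 * L) := by ring
        _ ≤ (1 / 10) * (α * L * L) := by linarith
        _ = α / 10 * (L : ℝ) ^ 2 := by ring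
    rw [hsplit] at hstep1
    linarith
  have hsq : (7 / 10 * α * (L : ℝ) ^ 2) ^ 2 ≤ 4 * (K * W) := by
    have h := pow_le_pow_left₀ (by positivity) hmain 2
    have e : (2 * (Real.sqrt K * Real.sqrt W)) ^ 2 = 4 * (K * W) := by
      rw [mul_pow, mul_pow, Real.sq_sqrt hK0, Real.sq_sqrt hW0]
      norm_num
    rwa [e] at h
  -- Step 4: `W ≤ 1200 ℓ₀² L²`
  have hWle : W ≤ 1200 * ℓ₀ ^ 2 * (L : ℝ) ^ 2 := by
    have hΛ2 : Real.log (4 / e₀) ^ 2 ≤ (15 / 2 * ℓ₀) ^ 2 := pow_le_pow_left₀ hΛ0 hΛ 2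
    -- `70 L/e₀ = 35840 ℓ₀ L/α ≤ 34 ℓ₀ L² ≤ 25 ℓ₀² L²`
    have h70 : 70 * (L : ℝ) / e₀ ≤ 34 * ℓ₀ * (L : ℝ) ^ 2 := by
      have e : 70 * (L : ℝ) / e₀ = 35840 * ℓ₀ * L / α := by
        rw [he₀]
        field_simp
        ring
      rw [e, div_le_iff₀ hα0]
      have h1 : 35840 * (L : ℝ) ≤ 34 * (α * L) * L := by
        have := mul_le_mul_of_nonneg_right hαL hL0'.le
        calc 35840 * (L : ℝ) ≤ 34 * (1060 * L) := by linarith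
          _ ≤ 34 * (α * L * L) := by linarith
          _ = 34 * (α * L) * L := by ring
      have h2 := mul_le_mul_of_nonneg_left h1 hℓ0.le
      have e1 : ℓ₀ * (35840 * (L : ℝ)) = 35840 * ℓ₀ * L := by ring
      have e2 : ℓ₀ * (34 * (α * L) * L) = 34 * ℓ₀ * (L : ℝ) ^ 2 * α := by ring
      rw [e1, e2] at h2
      exact h2
    have h34 : 34 * ℓ₀ * (L : ℝ) ^ 2 ≤ 25 * ℓ₀ ^ 2 * (L : ℝ) ^ 2 := by
      have h25 : (34 : ℝ) ≤ 25 * ℓ₀ := by linarith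
      have h : 34 * ℓ₀ ≤ 25 * ℓ₀ ^ 2 := by
        calc 34 * ℓ₀ ≤ (25 * ℓ₀) * ℓ₀ := mul_le_mul_of_nonneg_right h25 hℓ0.le
          _ = 25 * ℓ₀ ^ 2 := by ring
      have := mul_le_mul_of_nonneg_right h (sq_nonneg (L : ℝ))
      linarith
    have h20 : 20 * (L : ℝ) ^ 2 * Real.log (4 / e₀) ^ 2 ≤ 20 * (L : ℝ) ^ 2 * (15 / 2 * ℓ₀) ^ 2 :=
      mul_le_mul_of_nonneg_left hΛ2 (by positivity)
    have hpos : 0 ≤ ℓ₀ ^ 2 * (L : ℝ) ^ 2 := by positivity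
    calc W = 20 * (L : ℝ) ^ 2 * Real.log (4 / e₀) ^ 2 + 70 * L / e₀ := rfl
      _ ≤ 20 * (L : ℝ) ^ 2 * (15 / 2 * ℓ₀) ^ 2 + 25 * ℓ₀ ^ 2 * (L : ℝ) ^ 2 :=
          add_le_add h20 (h70.trans h34)
      _ = 1150 * (ℓ₀ ^ 2 * (L : ℝ) ^ 2) := by ring
      _ ≤ 1200 * (ℓ₀ ^ 2 * (L : ℝ) ^ 2) := by linarith
      _ = 1200 * ℓ₀ ^ 2 * (L : ℝ) ^ 2 := by ring
  -- Step 5: `49 α² L² ≤ 480000 ℓ₀² K`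
  have hcore : 49 * α ^ 2 * (L : ℝ) ^ 2 ≤ 480000 * ℓ₀ ^ 2 * K := by
    have h1' : (7 / 10 * α * (L : ℝ) ^ 2) ^ 2 ≤ 4 * (K * (1200 * ℓ₀ ^ 2 * (L : ℝ) ^ 2)) :=
      hsq.trans (mul_le_mul_of_nonneg_left (mul_le_mul_of_nonneg_left hWle hK0) (by norm_num))
    have hL2 : (0 : ℝ) < (L : ℝ) ^ 2 := by positivity
    have h3 : 49 * α ^ 2 * (L : ℝ) ^ 2 * (L : ℝ) ^ 2 ≤ 480000 * ℓ₀ ^ 2 * K * (L : ℝ) ^ 2 := by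
      have e2 : (7 / 10 * α * (L : ℝ) ^ 2) ^ 2 = (1 / 100) * (49 * α ^ 2 * (L : ℝ) ^ 2 * (L : ℝ) ^ 2) := by
        ring
      have e3 : 4 * (K * (1200 * ℓ₀ ^ 2 * (L : ℝ) ^ 2)) = (1 / 100) * (480000 * ℓ₀ ^ 2 * K * (L : ℝ) ^ 2) := by
        ring
      rw [e2, e3] at h1'
      linarith
    exact le_of_mul_le_mul_right h3 hL2
  -- conclusion: `a = 8 α²`, `8 · 480000 / 49 ≤ 100000`
  have hfin : a / (100000 * ℓ₀ ^ 2) * (L : ℝ) ^ 2 ≤ K := by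
    rw [div_mul_eq_mul_div, div_le_iff₀ (by positivity)]
    have ha8 : a = 8 * α ^ 2 := by rw [hα2]; ring
    rw [ha8]
    have hℓK : 0 ≤ ℓ₀ ^ 2 * K := mul_nonneg (sq_nonneg _) hK0
    calc 8 * α ^ 2 * (L : ℝ) ^ 2 = (8 / 49) * (49 * α ^ 2 * (L : ℝ) ^ 2) := by ring
      _ ≤ (8 / 49) * (480000 * ℓ₀ ^ 2 * K) := mul_le_mul_of_nonneg_left hcore (by norm_num)
      _ = (3840000 / 49) * (ℓ₀ ^ 2 * K) := by ring
      _ ≤ 100000 * (ℓ₀ ^ 2 * K) := by linarith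
      _ = K * (100000 * ℓ₀ ^ 2) := by ring
  rw [hK] at hfin
  linarith

/-- **`d`-wave pair LRO costs kinetic energy — level-uniform logarithmic rate at given side.** For
`a > 0`, every side `L ≥ ⌈3200/√a⌉ + 3`, every `N` and every unit `ψ ∈ szSector N 0` with
`Re ⟨ψ, Δ_d†Δ_d ψ⟩ ≥ a·L⁴`:
`minEnergyOn H₀ (szSector N 0) + a/(10⁵·log²(4 + 32/√a))·L² ≤ Re ⟨ψ, H₀ ψ⟩` (`N` is even, or the
sector is trivial). Same shape as `freeDWavePairing_costs_energy_opt_rate`; no condition on the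
filling. Bardeen–Cooper–Schrieffer (1957) §II; Van Hove (1953). [folklore] -/
theorem freeDWavePairing_costs_energy_uniform_rate {a : ℝ} (ha : 0 < a) {L : ℕ} [NeZero L]
    (hL : ⌈3200 / Real.sqrt a⌉₊ + 3 ≤ L) {N : ℕ} {ψ : Fock (Orb (FermionTorus 2 L))}
    (hψ : ψ ∈ szSector (Λ := FermionTorus 2 L) N 0) (h1 : star ψ ⬝ᵥ ψ = 1)
    (hY : a * (L : ℝ) ^ 4 ≤
      (star ψ ⬝ᵥ (((pairField dWaveFormFactor L)ᴴ * pairField dWaveFormFactor L) *ᵥ ψ)).re) :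
    (hubbardTorus 2 L 1 0).minEnergyOn (szSector (Λ := FermionTorus 2 L) N 0) +
        a / (100000 * Real.log (4 + 32 / Real.sqrt a) ^ 2) * (L : ℝ) ^ 2 ≤
      (star ψ ⬝ᵥ (hubbardTorus 2 L 1 0 *ᵥ ψ)).re := by
  have hL3 : 3 ≤ L := by omega
  have hsa : 0 < Real.sqrt a := Real.sqrt_pos.2 ha
  have hLa : 3200 ≤ Real.sqrt a * L := by
    have hceil : 3200 / Real.sqrt a ≤ (⌈3200 / Real.sqrt a⌉₊ : ℝ) := Nat.le_ceil _
    have hL' : (⌈3200 / Real.sqrt a⌉₊ : ℝ) + 3 ≤ (L : ℝ) := by exact_mod_cast hL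
    have hle : 3200 / Real.sqrt a ≤ (L : ℝ) := by linarith
    rw [div_le_iff₀ hsa] at hle
    linarith
  have h0 : ψ ≠ 0 := by rintro rfl; simp at h1
  obtain ⟨n, rfl⟩ := exists_eq_two_mul_of_mem_szSector_zero hψ h0
  exact freeDWavePairing_costs_energy_uniform_explicit ha hL3 hLa hψ h1 hY

/-- **A-priori form: small kinetic excess carries little `d`-wave pair order, at every filling.**
For `a > 0`, `L ≥ 3` with `√a·L ≥ 3200`, and a unit `ψ ∈ szSector (2n) 0` whose free kinetic energy is
less than `a/(10⁵·log²(4 + 32/√a))·L²` above the free sector ground energy: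
`Re ⟨ψ, Δ_d†Δ_d ψ⟩ < a·L⁴`. Bardeen–Cooper–Schrieffer (1957) §II. [folklore] -/
theorem re_expect_pairField_dWave_lt_of_energy_excess_lt_uniform {a : ℝ} (ha : 0 < a) (hL : 3 ≤ L)
    (hLa : 3200 ≤ Real.sqrt a * L) {n : ℕ} {ψ : Fock (Orb (FermionTorus 2 L))}
    (hψ : ψ ∈ szSector (Λ := FermionTorus 2 L) (2 * n) 0) (h1 : star ψ ⬝ᵥ ψ = 1)
    (hX : (star ψ ⬝ᵥ (hubbardTorus 2 L 1 0 *ᵥ ψ)).re <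
      (hubbardTorus 2 L 1 0).minEnergyOn (szSector (Λ := FermionTorus 2 L) (2 * n) 0) +
        a / (100000 * Real.log (4 + 32 / Real.sqrt a) ^ 2) * (L : ℝ) ^ 2) :
    (star ψ ⬝ᵥ (((pairField dWaveFormFactor L)ᴴ * pairField dWaveFormFactor L) *ᵥ ψ)).re <
      a * (L : ℝ) ^ 4 := by
  by_contra h
  push Not at h
  have := freeDWavePairing_costs_energy_uniform_explicit ha hL hLa hψ h1 h
  linarith

end Literature.MathematicalPhysics.QuantumLattice
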